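import Literature.Analysis.FunctionSpaces.LatticeDiffOpAdjoint
import Literature.Analysis.FunctionSpaces.LatticeSobolevSmooth
import HarnessLib

/-!
# The formal adjoint of a first-order lattice operator (Warner 6.24, 6.31 (2))

F. W. Warner, GTM 94 (1983), 6.24 (3)–(5): the formal adjoint `L*` of a periodic differential
operator and `⟨Lφ, ψ⟩ = ⟨φ, L*ψ⟩`; 6.31 (2) extends this to `u ∈ H_s` against test families. For a
first-order lattice operator `P = ∑_j P_j ∂_j + ∑_j p_j ⋆ ∂_j + p₀ ⋆` (`Lattice.POp1`) we construct the
adjoint as a first-order operator again,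

  `P.adj = ∑_j (-P_j†) ∂_j + ∑_j (-p_j†) ⋆ ∂_j + (p₀† - ∑_j ∂_j p_j†) ⋆`

(`adjSymb` the adjoint symbol), prove the adjunction `⟨P u, v⟩ = ⟨u, P.adj v⟩` for tempered `u`
and rapidly decreasing `v` (`POp1.pairing_apply_left`), the involutivity `P.adj.adj = P`, the symbol
`σ_{P.adj}(k) = -σ_P(k)†`, and that an `H₀`-bound for a multiplier passes to its adjoint symbol
(`eNorm_conv_adjSymb_le`, by duality).

## References

* F. W. Warner, GTM 94 (1983), 6.24 (3)–(5), 6.31 (2). [WarnerGTM94]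
-/

noncomputable section

open Filter Finset
open scoped ENNReal NNReal Topology InnerProductSpace ComplexConjugate

namespace Literature.Analysis.FunctionSpaces

namespace Lattice

open Torus

variable {d : Type*} [Fintype d]
variable {V W : Type*} [NormedAddCommGroup V] [InnerProductSpace ℂ V] [NormedAddCommGroup W]
  [InnerProductSpace ℂ W] [CompleteSpace V] [CompleteSpace W]

/-! ### Algebra of adjoint symbols -/

omit [InnerProductSpace ℂ V] [InnerProductSpace ℂ W] [CompleteSpace V] [CompleteSpace W] in
/-- Negatives of rapidly decreasing families (any normed space of values). [folklore] -/
theorem _root_.Literature.Analysis.FunctionSpaces.Torus.RapidDecay.neg_gen {X : Type*} [NormedAddCommGroup X]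
    [NormedSpace ℂ X] {c : (d → ℤ) → X} (hc : RapidDecay c) : RapidDecay (-c) := by
  simpa using hc.const_smul (-1)

omit [InnerProductSpace ℂ V] [InnerProductSpace ℂ W] [CompleteSpace V] [CompleteSpace W] in
/-- Differences of rapidly decreasing families (any normed space of values). [folklore] -/
theorem _root_.Literature.Analysis.FunctionSpaces.Torus.RapidDecay.sub_gen {X : Type*} [NormedAddCommGroup X]
    [NormedSpace ℂ X] {c c' : (d → ℤ) → X} (hc : RapidDecay c) (hc' : RapidDecay c') : RapidDecay (c - c') := by
  rw [sub_eq_add_neg]; exact hc.add hc'.neg_gen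

omit [Fintype d] in
/-- `(-a)† = -a†`. [folklore] -/
theorem adjSymb_neg (a : (d → ℤ) → (V →L[ℂ] W)) : adjSymb (-a) = -adjSymb a := by
  funext k; simp [adjSymb]

omit [Fintype d] in
/-- `(a - b)† = a† - b†`. [folklore] -/
theorem adjSymb_sub (a b : (d → ℤ) → (V →L[ℂ] W)) : adjSymb (a - b) = adjSymb a - adjSymb b := by
  funext k; simp [adjSymb]

omit [Fintype d] in
/-- `(∑ a_i)† = ∑ a_i†`. [folklore] -/
theorem adjSymb_finset_sum {ι : Type*} (s : Finset ι) (a : ι → (d → ℤ) → (V →L[ℂ] W)) :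
    adjSymb (∑ i ∈ s, a i) = ∑ i ∈ s, adjSymb (a i) := by
  funext k; simp [adjSymb, Finset.sum_apply, map_sum]

omit [Fintype d] in
/-- **`(∂_j a)† = ∂_j (a†)`** (`conj (2πi (-k)_j) = 2πi k_j`). [folklore] -/
theorem adjSymb_freqDeriv (j : d) (a : (d → ℤ) → (V →L[ℂ] W)) :
    adjSymb (freqDeriv j a) = freqDeriv j (adjSymb a) := by
  funext k
  simp only [adjSymb_apply, freqDeriv_apply, Pi.neg_apply, Int.cast_neg]
  rw [LinearIsometryEquiv.map_smulₛₗ ContinuousLinearMap.adjoint]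
  congr 1
  simp only [map_mul, map_neg, Complex.conj_ofReal, Complex.conj_I, map_intCast, map_ofNat]
  ring

omit [Fintype d] [InnerProductSpace ℂ V] [InnerProductSpace ℂ W] [CompleteSpace V] [CompleteSpace W] in
/-- A constant map commutes with `∂_j`. [folklore] -/
theorem freqDeriv_comp_clm [NormedSpace ℂ V] [NormedSpace ℂ W] (T : V →L[ℂ] W) (j : d) (v : (d → ℤ) → V) :
    freqDeriv j (fun k => T (v k)) = fun k => T (freqDeriv j v k) := by
  funext k; simp [freqDeriv_apply]

/-! ### The adjoint operator -/

namespace POp1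

variable (P : POp1 d V W)

/-- **The formal adjoint of a first-order lattice operator**, again of first order:
`P.adj = ∑_j (-P_j†) ∂_j + ∑_j (-p_j†) ⋆ ∂_j + (p₀† - ∑_j ∂_j p_j†) ⋆` (Warner 6.24 (3),
`(P_j ∂_j)* = -∂_j P_j† = -P_j† ∂_j - (∂_j P_j†)`). [cite: WarnerGTM94, 6.24 (3)] -/
def adj : POp1 d W V where
  P := fun j => -ContinuousLinearMap.adjoint (P.P j)
  p := fun j => -adjSymb (P.p j)
  p0 := adjSymb P.p0 - ∑ j, freqDeriv j (adjSymb (P.p j))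
  hp := fun j => (P.hp j).adjSymb.neg_gen
  hp0 := P.hp0.adjSymb.sub_gen (RapidDecay.finset_sum _ fun j _ => ((P.hp j).adjSymb.freqDeriv j))

/-- Frozen coefficients of the adjoint. [folklore] -/
@[simp] theorem adj_P (j : d) : P.adj.P j = -ContinuousLinearMap.adjoint (P.P j) := rfl

/-- Perturbation symbols of the adjoint. [folklore] -/
@[simp] theorem adj_p (j : d) : P.adj.p j = -adjSymb (P.p j) := rfl

/-- Zeroth-order symbol of the adjoint. [folklore] -/
theorem adj_p0 : P.adj.p0 = adjSymb P.p0 - ∑ j, freqDeriv j (adjSymb (P.p j)) := rfl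

omit [CompleteSpace V] [CompleteSpace W] in
/-- Extensionality for first-order lattice operators (the proof fields are propositions). [folklore] -/
theorem ext' {P Q : POp1 d V W} (hP : P.P = Q.P) (hp : P.p = Q.p) (h0 : P.p0 = Q.p0) : P = Q := by
  cases P; cases Q
  simp only at hP hp h0
  subst hP hp h0
  rfl

/-- **`P†† = P`.** [folklore] -/
theorem adj_adj : P.adj.adj = P := by
  refine ext' (funext fun j => by simp) (funext fun j => by simp [adjSymb_neg, adjSymb_adjSymb]) ?_
  rw [adj_p0, adj_p0, adjSymb_sub, adjSymb_adjSymb, adjSymb_finset_sum]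
  simp only [adj_p, adjSymb_neg, adjSymb_adjSymb, adjSymb_freqDeriv, freqDeriv_neg, Finset.sum_neg_distrib]
  abel

/-- **The symbol of the adjoint**: `σ_{P†}(k) = -σ_P(k)†`. [cite: WarnerGTM94, 6.24 (3)] -/
theorem adj_symbol (k : d → ℤ) : P.adj.symbol k = -ContinuousLinearMap.adjoint (P.symbol k) := by
  simp only [POp1.symbol, adj_P, smul_neg, Finset.sum_neg_distrib, map_sum]
  congr 1
  refine Finset.sum_congr rfl fun j _ => ?_
  rw [LinearIsometryEquiv.map_smulₛₗ ContinuousLinearMap.adjoint]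
  simp

omit [CompleteSpace V] in
/-- A first-order operator applied to a rapidly decreasing family is rapidly decreasing. [folklore] -/
theorem rapidDecay_apply (Q : POp1 d V W) {v : (d → ℤ) → V} (hv : RapidDecay v) : RapidDecay (Q.apply v) := by
  have h1 : (fun k => ∑ j, Q.P j (freqDeriv j v k)) = ∑ j, fun k => Q.P j (freqDeriv j v k) := by
    funext k; simp [Finset.sum_apply]
  rw [Q.apply_def, h1]
  exact ((RapidDecay.finset_sum _ fun j _ => (hv.freqDeriv' j).comp_apply _).add
    (RapidDecay.finset_sum _ fun j _ => (hv.freqDeriv' j).conv_right (Q.hp j))).add (hv.conv_right Q.hp0)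

/-- **The adjunction `⟨P u, v⟩ = ⟨u, P† v⟩`** for tempered `u` and rapidly decreasing `v`
(Warner 6.24 (5), 6.31 (2)). [cite: WarnerGTM94, 6.31 (2)] -/
theorem pairing_apply_left {u : (d → ℤ) → V} (hu : Tempered u) {v : (d → ℤ) → W} (hv : RapidDecay v) :
    pairing (P.apply u) v = pairing u (P.adj.apply v) := by
  have hvt : Tempered v := hv.tempered
  -- temperedness / rapid decrease of the pieces
  have tF : ∀ j, Tempered (fun k => P.P j (freqDeriv j u k)) := fun j => (hu.freqDeriv j).comp_apply _
  have tC : ∀ j, Tempered (conv (P.p j) (freqDeriv j u)) := fun j => (hu.freqDeriv j).conv (P.hp j)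
  have tZ : Tempered (conv P.p0 u) := hu.conv P.hp0
  have rF : ∀ j, RapidDecay (fun k => P.adj.P j (freqDeriv j v k)) := fun j => (hv.freqDeriv' j).comp_apply _
  have rC : ∀ j, RapidDecay (conv (P.adj.p j) (freqDeriv j v)) := fun j => (hv.freqDeriv' j).conv_right (P.adj.hp j)
  have rZ : RapidDecay (conv P.adj.p0 v) := hv.conv_right P.adj.hp0
  have rB : ∀ j, RapidDecay (conv (freqDeriv j (adjSymb (P.p j))) v) := fun j =>
    hv.conv_right ((P.hp j).adjSymb.freqDeriv j)
  have rC' : ∀ j, RapidDecay (conv (adjSymb (P.p j)) (freqDeriv j v)) := fun j =>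
    (hv.freqDeriv' j).conv_right (P.hp j).adjSymb
  -- left-hand side, term by term
  have hF : ∀ j, pairing (fun k => P.P j (freqDeriv j u k)) v = pairing u (fun k => P.adj.P j (freqDeriv j v k)) :=
    fun j => by
      rw [pairing_comp_left, ← freqDeriv_comp_clm, pairing_freqDeriv_left, freqDeriv_comp_clm, ← pairing_neg_right]
      congr 1
      funext k
      simp
  have hC : ∀ j, pairing (conv (P.p j) (freqDeriv j u)) v =
      -pairing u (conv (freqDeriv j (adjSymb (P.p j))) v) - pairing u (conv (adjSymb (P.p j)) (freqDeriv j v)) :=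
    fun j => by
      rw [pairing_conv_left' (P.hp j) (hu.freqDeriv j) hv, pairing_freqDeriv_left,
        freqDeriv_conv (P.hp j).adjSymb hvt j, pairing_add_right' hu (rB j) (rC' j)]
      ring
  have hZ : pairing (conv P.p0 u) v = pairing u (conv (adjSymb P.p0) v) := pairing_conv_left' P.hp0 hu hv
  -- assemble
  have hFs : pairing (fun k => ∑ j, P.P j (freqDeriv j u k)) v = ∑ j, pairing u (fun k => P.adj.P j (freqDeriv j v k)) := by
    have : (fun k => ∑ j, P.P j (freqDeriv j u k)) = ∑ j, fun k => P.P j (freqDeriv j u k) := by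
      funext k; simp [Finset.sum_apply]
    rw [this, pairing_finset_sum_left _ (fun j _ => tF j) hv]
    exact Finset.sum_congr rfl fun j _ => hF j
  have htF : Tempered (fun k => ∑ j, P.P j (freqDeriv j u k)) := by
    have : (fun k => ∑ j, P.P j (freqDeriv j u k)) = ∑ j, fun k => P.P j (freqDeriv j u k) := by
      funext k; simp [Finset.sum_apply]
    rw [this]; exact Tempered.finset_sum _ fun j _ => tF j
  rw [P.apply_def, pairing_add_left' (htF.add (Tempered.finset_sum _ fun j _ => tC j)) tZ hv,
    pairing_add_left' htF (Tempered.finset_sum _ fun j _ => tC j) hv, hFs,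
    pairing_finset_sum_left _ (fun j _ => tC j) hv, Finset.sum_congr rfl fun j _ => hC j, hZ]
  -- right-hand side
  have hrF : (fun k => ∑ j, P.adj.P j (freqDeriv j v k)) = ∑ j, fun k => P.adj.P j (freqDeriv j v k) := by
    funext k; simp [Finset.sum_apply]
  rw [P.adj.apply_def, hrF, pairing_add_right' hu ((RapidDecay.finset_sum _ fun j _ => rF j).add
      (RapidDecay.finset_sum _ fun j _ => rC j)) rZ,
    pairing_add_right' hu (RapidDecay.finset_sum _ fun j _ => rF j) (RapidDecay.finset_sum _ fun j _ => rC j),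
    pairing_finset_sum_right _ hu (fun j _ => rF j), pairing_finset_sum_right _ hu (fun j _ => rC j), adj_p0,
    sub_conv P.hp0.adjSymb (RapidDecay.finset_sum _ fun j _ => (P.hp j).adjSymb.freqDeriv j) hvt,
    pairing_sub_right' hu (hv.conv_right P.hp0.adjSymb) (hv.conv_right (RapidDecay.finset_sum _ fun j _ =>
      (P.hp j).adjSymb.freqDeriv j)),
    finset_sum_conv _ (fun j _ => (P.hp j).adjSymb.freqDeriv j) hvt, pairing_finset_sum_right _ hu (fun j _ => rB j)]
  simp only [adj_p, neg_conv, pairing_neg_right, Finset.sum_neg_distrib, Finset.sum_sub_distrib]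
  ring

/-- The mirrored adjunction `⟨P† u, v⟩ = ⟨u, P v⟩`. [cite: WarnerGTM94, 6.31 (2)] -/
theorem pairing_adj_apply_left {u : (d → ℤ) → W} (hu : Tempered u) {v : (d → ℤ) → V} (hv : RapidDecay v) :
    pairing (P.adj.apply u) v = pairing u (P.apply v) := by
  have := P.adj.pairing_apply_left hu hv
  rwa [adj_adj] at this

end POp1

/-! ### `H₀` bounds pass to adjoint multipliers -/

omit [CompleteSpace V] in
/-- `‖w‖₀²` read in `ℝ` is `Re ⟨w, w⟩`. [folklore] -/
theorem toReal_eNormSq_zero_eq_re_pairing {w : (d → ℤ) → V} (hw : eNormSq 0 w < ∞) :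
    (eNormSq 0 w).toReal = (pairing w w).re := by
  have hw' : eNormSq (-0) w < ∞ := by simpa using hw
  rw [← (Complex.hasSum_re (hasSum_pairing hw hw')).tsum_eq, eNormSq,
    ENNReal.tsum_toReal_eq fun k => ENNReal.mul_ne_top ENNReal.ofReal_ne_top (ENNReal.pow_ne_top enorm_ne_top)]
  refine tsum_congr fun k => ?_
  rw [toReal_term, sobolevWeight_zero, one_pow, one_mul, ← inner_self_eq_norm_sq (𝕜 := ℂ)]
  rfl

/-- **Duality for multiplier bounds**: if `‖a ⋆ c‖₀ ≤ ε ‖c‖₀` on `H₀` (finite `ε`) then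
`‖a† ⋆ c‖₀ ≤ ε ‖c‖₀` (`‖a† ⋆ c‖₀² = Re ⟨c, a ⋆ (a† ⋆ c)⟩ ≤ ‖c‖₀ ε ‖a† ⋆ c‖₀`). [folklore] -/
theorem eNorm_conv_adjSymb_le {a : (d → ℤ) → (V →L[ℂ] W)} (ha : RapidDecay a) {ε : ℝ≥0∞} (hε : ε ≠ ⊤)
    (h : ∀ c : (d → ℤ) → V, eNormSq 0 c < ∞ → eNorm 0 (conv a c) ≤ ε * eNorm 0 c)
    (c : (d → ℤ) → W) (hc : eNormSq 0 c < ∞) : eNorm 0 (conv (adjSymb a) c) ≤ ε * eNorm 0 c := by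
  set w := conv (adjSymb a) c with hw
  have hwfin : eNormSq 0 w < ∞ := eNormSq_conv_lt_top ha.adjSymb hc
  have hawfin : eNormSq 0 (conv a w) < ∞ := eNormSq_conv_lt_top ha hwfin
  -- real-valued norms
  set nw : ℝ := (eNorm 0 w).toReal with hnw
  set nc : ℝ := (eNorm 0 c).toReal with hnc
  have hnw_sq : nw ^ 2 = (eNormSq 0 w).toReal := by
    rw [hnw, ← ENNReal.toReal_pow, eNorm_pow_two]
  -- `‖w‖₀² ≤ ‖c‖₀ · ε · ‖w‖₀`
  have hpair : pairing w w = pairing c (conv a w) := by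
    rw [hw, pairing_conv_left ha.adjSymb (s := 0) hc (by simpa using hwfin), adjSymb_adjSymb]
  have hkey : nw ^ 2 ≤ nc * (ε.toReal * nw) := by
    rw [hnw_sq, toReal_eNormSq_zero_eq_re_pairing hwfin, hpair]
    refine (Complex.re_le_norm _).trans ((norm_pairing_le (s := 0) hc (by simpa using hawfin)).trans ?_)
    refine mul_le_mul_of_nonneg_left ?_ ENNReal.toReal_nonneg
    have h2 := h w hwfin
    have := (ENNReal.toReal_le_toReal (eNorm_lt_top_iff.2 hawfin).ne
      (ENNReal.mul_ne_top hε (eNorm_lt_top_iff.2 hwfin).ne)).2 h2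
    simpa [ENNReal.toReal_mul] using this
  -- conclude in `ℝ`, then return to `ℝ≥0∞`
  have hreal : nw ≤ ε.toReal * nc := by
    have hnw0 : 0 ≤ nw := ENNReal.toReal_nonneg
    have hnc0 : 0 ≤ nc := ENNReal.toReal_nonneg
    by_cases h0 : nw = 0
    · rw [h0]; positivity
    · have hpos : 0 < nw := lt_of_le_of_ne hnw0 (Ne.symm h0)
      have : nw * nw ≤ (ε.toReal * nc) * nw := by nlinarith
      exact le_of_mul_le_mul_right this hpos
  calc eNorm 0 w = ENNReal.ofReal nw := (ENNReal.ofReal_toReal (eNorm_lt_top_iff.2 hwfin).ne).symm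
    _ ≤ ENNReal.ofReal (ε.toReal * nc) := ENNReal.ofReal_le_ofReal hreal
    _ = ε * eNorm 0 c := by
      rw [ENNReal.ofReal_mul ENNReal.toReal_nonneg, ENNReal.ofReal_toReal hε,
        ENNReal.ofReal_toReal (eNorm_lt_top_iff.2 hc).ne]

end Lattice

end Literature.Analysis.FunctionSpaces
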